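import Literature.NumberTheory.GaloisRepresentations.IdeleTruncatedSLocalLayerClass
import Literature.NumberTheory.GaloisRepresentations.LocalUnitsInflationTwoInjective
import HarnessLib

/-!
# [P2-mono], the local-global step at `H²(U, Ī_S)`, II: a class of `H²(U, Ī_S)` all of whose conjugated local pull-backs
# vanish is zero — FROM the finite-level statement (Harari Prop. 17.25 / Milne I Lemma 4.13 at `r = 2`, injectivity half)

Topic `NumberTheory/GaloisRepresentations`; namespace `Literature.NumberTheory.GaloisRepresentations.IdeleReadout`.
Theorems only; NO named fact, no `sorry`, no instance, no notation; number fields in `Type`.  Second file of P2-e/f of the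
[P2-mono] plan `P2-MONO-SCOPING-w3g18-v2.md` (lane «PT-Ш-S-TC» of crux `stmt-BirchSwinnertonDyer-19032`, cell bsd-eis; LEAD
bsd-line-x1-p1 g11).  Sequel of `IdeleTruncatedSLocalLayerClass` (the finite-level datum `locLayerClass` and
`locComponent_relInflGIS_eq_inflG_locLayerClass`: the `(w,t)`-component of `relInflGIS c` is the local inflation of
`locLayerClass … c`), of P2-a (-w3 g18 `IdeleTruncatedSRelativeLayers.exists_relInflGIS_eq`: every class of `Ext²_{C_U}(ℤ, Res_U Ī_S)`
is `relInflGIS c`) and of -w4 g21's `LocalUnitsInflationTwoInjective` (`inflG_comap_conjHom_res_unitsD_completion_two_injective`: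
the local inflation from the layer `N_{w,t}` of `V_w` with coefficients `Res_{V_w} K̄_wˣ` is injective on `H²` — Hilbert 90 at
every layer of `K_w`, -w3's P2-c).

* **`p2mono_of_finite`**: [P2-mono] in the VERBATIM binder of -w4 g20's `idLocMap_injective_two_of_inputs''` (E4e) / -w2 g12's
  `natural_at_of_P2mono` (`hP2`), FROM the finite-level vanishing statement of P2-b (bsd-eis -w8 g13
  `IdeleClassBar.eq_zero_of_forall_locLayerClass_eq_zero`, displayed here as the hypothesis `hfinite` until it lands).

HONEST FRAMING: assembly; the finite-level analysis (Tate, C–F VII §7.3 over `E^{H}`, the `σ₀`-matching) is quoted, not proved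
here.  No case of Poitou–Tate duality and nothing about BSD is proved.  AI formalisation, established only by the kernel check.

## References
* D. Harari, *Galois Cohomology and Class Field Theory*, Universitext (2020), §17.5 Lemma 17.23, Prop. 17.25; §4.3 (2)–(3).
  [Harari2020]
* J. S. Milne, *Arithmetic Duality Theorems*, 2nd ed. (2006), I Lemma 4.13, I Thm. 4.10 (a) (proof, p. 58). [MilneADT2006]
* J.-P. Serre, *Galois Cohomology* (1997), I §2.2 Prop. 8, §2.4. [SerreGaloisCohomology1997]
-/

noncomputable section

open NumberField IsDedekindDomain Field CategoryTheory CategoryTheory.Limits CategoryTheory.Abelian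
open Literature.Algebra.Homology Literature.Algebra.Homology.DiscreteRep
open scoped Classical

namespace Literature.NumberTheory.GaloisRepresentations

namespace IdeleReadout

open IdeleClassBar DiscreteGaloisModule
open Literature.NumberTheory.GaloisRepresentations.LocalWeilDatum (galFixing)

variable (K : Type) [Field K] [NumberField K] (S : Finset (HeightOneSpectrum (𝓞 K)))
  (U : Subgroup (GaloisGroupUnramifiedOutside K (↑S : Set (HeightOneSpectrum (𝓞 K))))) [hUn : U.Normal]

/-! ## [P2-mono] from the finite-level statement (P2-b) -/

/-- **[P2-mono] in -w4 g20's verbatim binder, FROM the finite-level vanishing statement of P2-b** (bsd-eis -w8 g13,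
displayed as the hypothesis `hfinite`): a class `y ∈ H²(U, Ī_S)` all of whose conjugated local pull-backs vanish is zero —
write `y = relInflGIS c` (P2-a), read each `(w,t)`-component as the local inflation of `locLayerClass … c` (§2), kill the
finite-level data by the injectivity of the local inflations (-w4 g21), and conclude `c = 0` by P2-b.
[cite: Harari2020, §17.5 Prop. 17.25][cite: MilneADT2006, I Lemma 4.13, I Thm. 4.10 (a) (proof, p. 58)] -/
theorem p2mono_of_finite
    (hU : IsOpen (U : Set (GaloisGroupUnramifiedOutside K (↑S : Set (HeightOneSpectrum (𝓞 K))))))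
    (hfinite : ∀ (E : GalLayer K)
      (hE : ramificationSubgroup K (↑S : Set (HeightOneSpectrum (𝓞 K))) ≤ galFixing K E.1)
      (hEU : (layerSubgroupS S E : Subgroup (GaloisGroupUnramifiedOutside K (↑S : Set (HeightOneSpectrum (𝓞 K))))) ≤ U)
      (c : groupCohomology (haveI := E.numberField;
        Rep.res (subgroupImageS S hE U).subtype (IdeleHerbrand.truncRep K E.1 S)) 2),
      (∀ (w : OverS K S) (t : DoubleCosets (decompMapPlaceS K S w.1) U), locLayerClass K S U w t hE hEU 2 c = 0) →
        c = 0)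
    (y : Ext (triv (k := ℤ) (Γ := ↥U) ℤ) ((resD ℤ U).obj (truncIdeleBarD K S)) 2)
    (hy : ∀ (w : OverS K S) (t : DoubleCosets (decompMapPlaceS K S w.1) U),
      (y.mapExactFunctor (resDHom ℤ (conjHom (decompMapPlaceS K S w.1) U (dcRep (decompMapPlaceS K S w.1) U t))
        (continuous_conjHom (decompMapPlaceS K S w.1) (continuous_decompMapPlaceS K S w.1) U
          (dcRep (decompMapPlaceS K S w.1) U t)))).comp
        (Ext.mk₀ (conjCoeff (decompMapPlaceS K S w.1) (continuous_decompMapPlaceS K S w.1) U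
          (truncIdeleBarD K S) (unitsD (Place.Completion w.1)) (locQ K S w) (dcRep (decompMapPlaceS K S w.1) U t)
          (k := ℤ))) (add_zero 2) = 0) :
    y = 0 := by
  obtain ⟨E, hE, hEU, c, rfl⟩ := exists_relInflGIS_eq S U hU 2 y
  have hc : c = 0 := hfinite E hE hEU c fun w t =>
    inflG_comap_conjHom_res_unitsD_completion_two_injective K S w.1 U hU (dcRep (decompMapPlaceS K S w.1) U t)
      (layerSubgroupS S E) hEU
      (by rw [← locComponent_relInflGIS_eq_inflG_locLayerClass, map_zero]; exact hy w t)
  rw [hc, map_zero]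

end IdeleReadout

end Literature.NumberTheory.GaloisRepresentations

end
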